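import Summits.MatrixMultiplication.MatrixMultiplication.Theorems.OutsiderSandwichAmortised
import HarnessLib

/-!
# No tight exchange: `⟨m⟩ ⊠ C₁^{⊠N} ⋭ ⟨m⟩ ⊠ ⟨2,2,2⟩^{⊠N}` — the star's outputs are coupled

Route `OutsiderSandwich` (decomposition cell `decomp-mm`, lens 4 «minimal counterexample /
extremal reduction», gen 28), support for the aside leaf `BlockOneIsMM`
(stmt-MatrixMultiplication-27147).

`OutsiderSandwichAmortised.blockOneIsMM_of_tight` showed that a TIGHT amortised certificate
`⟨m⟩ ⊠ C₁^{⊠N} ⊵ ⟨m⟩ ⊠ ⟨2,2,2⟩^{⊠N}` at a single level would decide the leaf.  This file closes that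
door for RESTRICTION at every level and every multiplicity (Kernel II is the case `m = 1`):

**Theorem** (`not_tight`). For all `N, m ≥ 1`, `⟨m⟩ ⊠ C₁^{⊠N}` does not restrict to
`⟨m⟩ ⊠ ⟨2,2,2⟩^{⊠N}`.

The obstruction is NOT spectral (both tensors have the same value at every gauge point and, by
lens 2, the same quantum functionals) and not a flattening count; it is the one linear relation
between the two outputs of the star `𝔖 : (X; y, y') ↦ (Xy, Xᵀy')`, namely `y'·(Xy) = y·(Xᵀy')`:

* the coupled block is, along the decoder `Fin 4 ≃ Fin 2 × Fin 2`, the pair tensor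
  `P : (X; u, w) ↦ (Xu, Xᵀw)` (`coupling₁_eq_pairTensor`), which is SYMMETRIC in its input and
  output legs; consequently every input-leg slice `S_ω = ∑_y ω(y) P(·, y, ·)` of
  `⟨m⟩ ⊠ P^{⊠N}` — a square matrix (matrix leg × output leg) — has the explicit kernel vector
  `ρ(z) = ± ω(z)` (sign = the half of the first letter of `z`), so NO input slice is invertible
  (`slice_mulVec_sgnWeight`, `not_isUnit_slice`);
* the input slice of `⟨m⟩ ⊠ ⟨2,2,2⟩^{⊠N}` at the weight «`X` = identity pattern» IS the identity
  matrix (`slice_matMul_idWeight`);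
* a restriction `t = (A, B, C)·s` between tensors of the SAME cubic format transports slices,
  `S^t_{w'} = A · S^s_{B^T w'} · Cᵀ` (`slice_restrict`), and `A S Cᵀ = 1` between square matrices
  forces `S` to be invertible (`mul_eq_one_comm`) — contradiction.

Equal formats are essential (`B = m + 1` helping copies escape: `⟨3⟩ ⊠ C₁ ⊵ ⟨2⟩ ⊠ ⟨2,2,2⟩`,
`OutsiderSandwichYield`), so this is the floor `r(N, m) ≥ m + 1` of the amortised exchange table,
not a bound on its growth; the leaf lives at ratio `2^{o(N)}`.

## References
* D. Coppersmith, S. Winograd, *Matrix multiplication via arithmetic progressions*,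
  J. Symbolic Comput. 9 (1990) 251–280, §7. [CoppersmithWinograd1990]
* P. Bürgisser, M. Clausen, M. A. Shokrollahi, *Algebraic Complexity Theory*, Springer (1997),
  §14.4 (restriction, isomorphic tensors), Lemma 15.23. [BurgisserClausenShokrollahi1997]
* M. Bläser, *Fast Matrix Multiplication*, Theory of Computing Graduate Surveys 5 (2013), §4–§5.
  [Blaser2013]
-/

noncomputable section

open scoped BigOperators Matrix

set_option linter.dupNamespace false
set_option autoImplicit false

namespace Summit.MatrixMultiplication.MatrixMultiplication.Theorems.OutsiderSandwichNoTightExchange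

open Literature.Computability.AlgebraicComplexity
open Summit.MatrixMultiplication.MatrixMultiplication.Theorems.OutsiderSandwichCoupling (coupling₁)
open Summit.MatrixMultiplication.MatrixMultiplication.Theorems.OutsiderSandwichBlockNormalForm
  (pairTensor decode coupling₁_eq_pairTensor)
open Summit.MatrixMultiplication.MatrixMultiplication.Theorems.OutsiderSandwichExchangeRate
  (Helped not_helped_one)

/-! ## 1. Input-leg slices and their transport under restriction -/

section Slice

variable {K : Type} [CommRing K]
variable {ι κ μ ι' κ' μ' : Type} [Fintype κ]

/-- The input-leg (leg-2) slice of a tensor at a weight `w`: the matrix `(a, c) ↦ ∑_b w b · u a b c`.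
[cite: BurgisserClausenShokrollahi1997, §14.4] -/
def slice (u : ι → κ → μ → K) (w : κ → K) : Matrix ι μ K :=
  Matrix.of fun a c => ∑ b, w b * u a b c

/-- Entries of the slice. [cite: BurgisserClausenShokrollahi1997, §14.4] -/
@[simp] theorem slice_apply (u : ι → κ → μ → K) (w : κ → K) (a : ι) (c : μ) :
    slice u w a c = ∑ b, w b * u a b c := rfl

/-- **Slices transport under restriction**: if `t = (A, B, C)·s` entrywise then
`S^t_{w'} = A · S^s_{Bᵀ w'} · Cᵀ`. [cite: BurgisserClausenShokrollahi1997, §14.4] -/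
theorem slice_restrict [Fintype ι] [Fintype μ] [Fintype ι'] [Fintype κ'] [Fintype μ']
    {s : ι → κ → μ → K} {t : ι' → κ' → μ' → K}
    (A : ι' → ι → K) (B : κ' → κ → K) (C : μ' → μ → K)
    (h : ∀ a' b' c', t a' b' c' = ∑ a, ∑ b, ∑ c, A a' a * B b' b * C c' c * s a b c)
    (w' : κ' → K) :
    slice t w' = Matrix.of A * slice s (fun b => ∑ b', w' b' * B b' b) * (Matrix.of C)ᵀ := by
  ext a' c'
  simp only [slice_apply, Matrix.mul_apply, Matrix.transpose_apply, Matrix.of_apply, h,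
    Finset.mul_sum, Finset.sum_mul]
  -- LHS: ∑ b', ∑ a, ∑ b, ∑ c ;  RHS: ∑ c, ∑ a, ∑ b, ∑ b'
  calc ∑ b', ∑ a, ∑ b, ∑ c, w' b' * (A a' a * B b' b * C c' c * s a b c)
      = ∑ a, ∑ b', ∑ b, ∑ c, w' b' * (A a' a * B b' b * C c' c * s a b c) := Finset.sum_comm
    _ = ∑ a, ∑ b, ∑ b', ∑ c, w' b' * (A a' a * B b' b * C c' c * s a b c) :=
        Finset.sum_congr rfl fun _ _ => Finset.sum_comm
    _ = ∑ a, ∑ b, ∑ c, ∑ b', w' b' * (A a' a * B b' b * C c' c * s a b c) :=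
        Finset.sum_congr rfl fun _ _ => Finset.sum_congr rfl fun _ _ => Finset.sum_comm
    _ = ∑ a, ∑ b, ∑ c, ∑ b', A a' a * (w' b' * B b' b * s a b c) * C c' c :=
        Finset.sum_congr rfl fun _ _ => Finset.sum_congr rfl fun _ _ =>
          Finset.sum_congr rfl fun _ _ => Finset.sum_congr rfl fun _ _ => by ring
    _ = ∑ a, ∑ c, ∑ b, ∑ b', A a' a * (w' b' * B b' b * s a b c) * C c' c :=
        Finset.sum_congr rfl fun _ _ => Finset.sum_comm
    _ = ∑ c, ∑ a, ∑ b, ∑ b', A a' a * (w' b' * B b' b * s a b c) * C c' c := Finset.sum_comm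

/-- `A · S · Cᵀ = 1` between square matrices of one format makes `S` invertible.
[cite: BurgisserClausenShokrollahi1997, §14.4] -/
theorem isUnit_of_conj_eq_one {J : Type} [Fintype J] [DecidableEq J] {L : Type} [Field L]
    (A S C : Matrix J J L) (h : A * S * C = 1) : IsUnit S := by
  have h1 : A * (S * C) = 1 := by rw [← Matrix.mul_assoc, h]
  have h2 : S * C * A = 1 := mul_eq_one_comm.mp h1
  have h3 : S * (C * A) = 1 := by rw [← Matrix.mul_assoc, h2]
  have h4 : C * A * S = 1 := mul_eq_one_comm.mp h3
  exact ⟨⟨S, C * A, h3, h4⟩, rfl⟩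

/-- An invertible matrix has no non-zero kernel vector. [folklore] -/
theorem mulVec_eq_zero_of_isUnit {J : Type} [Fintype J] [DecidableEq J] {L : Type} [Field L]
    {S : Matrix J J L} (hS : IsUnit S) {v : J → L} (hv : S.mulVec v = 0) : v = 0 := by
  have hdet : IsUnit S.det := (Matrix.isUnit_iff_isUnit_det S).mp hS
  calc v = (S⁻¹ * S).mulVec v := by rw [Matrix.nonsing_inv_mul S hdet, Matrix.one_mulVec]
    _ = 0 := by rw [← Matrix.mulVec_mulVec, hv, Matrix.mulVec_zero]

end Slice

/-! ## 2. The two sides in one cubic format -/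

section Sides

variable (N m : ℕ)

/-- The common cubic format `Fin m × (Fin N → Fin 2 × Fin 2)` of both sides. -/
abbrev J : Type := Fin m × (Fin N → Fin 2 × Fin 2)

/-- The target `⟨m⟩ ⊠ ⟨2,2,2⟩^{⊠N}`. -/
abbrev tgt : J N m → J N m → J N m → ℂ :=
  kroneckerTensor (unitTensor ℂ m) (kroneckerPow (matMulTensor ℂ 2 2 2) N)

/-- The source in decoded coordinates, `⟨m⟩ ⊠ P^{⊠N}` with `P` the pair tensor
`(X; u, w) ↦ (Xu, Xᵀw)` (`= C₁` along `decode`). -/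
abbrev src : J N m → J N m → J N m → ℂ :=
  kroneckerTensor (unitTensor ℂ m) (kroneckerPow (pairTensor 2) N)

/-- `⟨m⟩ ⊠ P^{⊠N} ⊵ ⟨m⟩ ⊠ C₁^{⊠N}` (re-indexing along the decoder). [cite: CoppersmithWinograd1990, §7] -/
theorem src_restrictsTo_coupling :
    TensorRestrictsTo (src N m)
      (kroneckerTensor (unitTensor ℂ m) (kroneckerPow coupling₁ N)) := by
  have hfun : kroneckerTensor (unitTensor ℂ m) (kroneckerPow coupling₁ N) =
      fun x y z => src N m (x.1, fun j => decode (x.2 j)) (y.1, fun j => decode (y.2 j))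
        (z.1, fun j => decode (z.2 j)) := by
    funext x y z
    simp only [kroneckerTensor_apply, kroneckerPow_apply, coupling₁_eq_pairTensor]
  rw [hfun]
  exact tensorRestrictsTo_precomp (src N m) _ _ _

/-- The pair tensor is symmetric in its input and output legs. [cite: CoppersmithWinograd1990, §7] -/
theorem pairTensor_symm (a y z : Fin 2 × Fin 2) : pairTensor 2 a y z = pairTensor 2 a z y := by
  unfold pairTensor
  have hiff : (y.1 = 0 ∧ z.1 = 1 ∧ y.2 = a.2 ∧ z.2 = a.1 ∨ y.1 = 1 ∧ z.1 = 0 ∧ y.2 = a.1 ∧ z.2 = a.2) ↔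
      (z.1 = 0 ∧ y.1 = 1 ∧ z.2 = a.2 ∧ y.2 = a.1 ∨ z.1 = 1 ∧ y.1 = 0 ∧ z.2 = a.1 ∧ y.2 = a.2) := by
    constructor
    · rintro (⟨h1, h2, h3, h4⟩ | ⟨h1, h2, h3, h4⟩)
      · exact Or.inr ⟨h2, h1, h4, h3⟩
      · exact Or.inl ⟨h2, h1, h4, h3⟩
    · rintro (⟨h1, h2, h3, h4⟩ | ⟨h1, h2, h3, h4⟩)
      · exact Or.inr ⟨h2, h1, h4, h3⟩
      · exact Or.inl ⟨h2, h1, h4, h3⟩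
  rw [if_congr hiff rfl rfl]

/-- The unit tensor is symmetric in its last two legs. [folklore] -/
theorem unitTensor_symm (i j k : Fin m) : unitTensor ℂ m i j k = unitTensor ℂ m i k j := by
  simp only [unitTensor_apply]
  have hiff : (i = j ∧ j = k) ↔ (i = k ∧ k = j) :=
    ⟨fun ⟨h1, h2⟩ => ⟨h1.trans h2, h2.symm⟩, fun ⟨h1, h2⟩ => ⟨h1.trans h2, h2.symm⟩⟩
  rw [if_congr hiff rfl rfl]

/-- The source is symmetric in its input and output legs. [cite: CoppersmithWinograd1990, §7] -/
theorem src_symm (a y z : J N m) : src N m a y z = src N m a z y := by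
  simp only [kroneckerTensor_apply, kroneckerPow_apply]
  rw [unitTensor_symm]
  congr 1
  exact Finset.prod_congr rfl fun j _ => pairTensor_symm _ _ _

/-- On the support of the pair tensor the input and output letters lie in opposite halves.
[cite: CoppersmithWinograd1990, §7] -/
theorem pairTensor_halves {a y z : Fin 2 × Fin 2} (h : pairTensor 2 a y z ≠ 0) : y.1 ≠ z.1 := by
  unfold pairTensor at h
  split_ifs at h with hc
  · rcases hc with ⟨h1, h2, -, -⟩ | ⟨h1, h2, -, -⟩ <;> rw [h1, h2] <;> decide
  · exact absurd rfl h

/-- On the support of the source the first input and output letters lie in opposite halves.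
[cite: CoppersmithWinograd1990, §7] -/
theorem src_halves (hN : 1 ≤ N) {a y z : J N m} (h : src N m a y z ≠ 0) :
    (y.2 ⟨0, hN⟩).1 ≠ (z.2 ⟨0, hN⟩).1 := by
  refine pairTensor_halves (a := a.2 ⟨0, hN⟩) fun h0 => h ?_
  simp only [kroneckerTensor_apply, kroneckerPow_apply]
  rw [Finset.prod_eq_zero (Finset.mem_univ (⟨0, hN⟩ : Fin N)) h0, mul_zero]

variable {N m}

/-- The sign of an index: `+1` on the half `u`, `-1` on the half `w` of its first letter. -/
def sgn (hN : 1 ≤ N) (z : J N m) : ℂ := if (z.2 ⟨0, hN⟩).1 = 0 then 1 else -1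

/-- Opposite halves have opposite signs. [folklore] -/
theorem sgn_add_sgn (hN : 1 ≤ N) {y z : J N m} (h : (y.2 ⟨0, hN⟩).1 ≠ (z.2 ⟨0, hN⟩).1) :
    sgn hN z + sgn hN y = 0 := by
  unfold sgn
  generalize (y.2 ⟨0, hN⟩).1 = p at h ⊢
  generalize (z.2 ⟨0, hN⟩).1 = q at h ⊢
  fin_cases p <;> fin_cases q <;> simp_all

/-- `sgn z * sgn z = 1`. [folklore] -/
theorem sgn_mul_self (hN : 1 ≤ N) (z : J N m) : sgn hN z * sgn hN z = 1 := by
  unfold sgn; split_ifs <;> norm_num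

/-- **The coupling relation `y'·(Xy) = y·(Xᵀy')`, tensorised**: `ρ(z) = sgn z · ω(z)` is a
kernel vector of the input slice of `⟨m⟩ ⊠ P^{⊠N}` at `ω`. [cite: CoppersmithWinograd1990, §7] -/
theorem slice_mulVec_sgn (hN : 1 ≤ N) (ω : J N m → ℂ) :
    (slice (src N m) ω).mulVec (fun z => sgn hN z * ω z) = 0 := by
  funext a
  simp only [Matrix.mulVec, dotProduct, slice_apply, Pi.zero_apply, Finset.sum_mul]
  -- `T = ∑_z ∑_y F y z` with `F y z = ω y · src a y z · (sgn z · ω z)`; symmetry gives `2T = 0`.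
  have hT : ∑ z, ∑ y, ω y * src N m a y z * (sgn hN z * ω z) =
      ∑ z, ∑ y, ω y * src N m a y z * (sgn hN y * ω z) := by
    rw [Finset.sum_comm]
    refine Finset.sum_congr rfl fun p _ => Finset.sum_congr rfl fun q _ => ?_
    rw [src_symm N m a p q]
    ring
  have hvan : ∀ y z, ω y * src N m a y z * (sgn hN z * ω z) +
      ω y * src N m a y z * (sgn hN y * ω z) = 0 := by
    intro y z
    by_cases hs : src N m a y z = 0
    · rw [hs]; ring
    · have hsum := sgn_add_sgn hN (src_halves N m hN hs)
      calc ω y * src N m a y z * (sgn hN z * ω z) + ω y * src N m a y z * (sgn hN y * ω z)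
          = ω y * src N m a y z * ω z * (sgn hN z + sgn hN y) := by ring
        _ = 0 := by rw [hsum, mul_zero]
  have h2 : ∑ z, ∑ y, ω y * src N m a y z * (sgn hN z * ω z) +
      ∑ z, ∑ y, ω y * src N m a y z * (sgn hN y * ω z) = 0 := by
    rw [← Finset.sum_add_distrib]
    refine Finset.sum_eq_zero fun z _ => ?_
    rw [← Finset.sum_add_distrib]
    exact Finset.sum_eq_zero fun y _ => hvan y z
  rw [← hT, ← two_mul] at h2
  exact (mul_eq_zero.mp h2).resolve_left two_ne_zero

/-- The identity-pattern weight on the target's input leg: `1` on `X`-indices whose every letter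
is diagonal. -/
def idWeight (N m : ℕ) : J N m → ℂ := fun x => if ∀ j, (x.2 j).1 = (x.2 j).2 then 1 else 0

/-- **The input slice of `⟨m⟩ ⊠ ⟨2,2,2⟩^{⊠N}` at the identity pattern is the identity matrix**
(`X = I`: `Z = X Y = Y`). [cite: BurgisserClausenShokrollahi1997, §14.4] -/
theorem slice_tgt_idWeight (N m : ℕ) : slice (tgt N m) (idWeight N m) = 1 := by
  have matMulTensor_apply' : ∀ (a b c : Fin 2 × Fin 2), matMulTensor ℂ 2 2 2 a b c =
      if a.1 = b.1 ∧ b.2 = c.1 ∧ a.2 = c.2 then 1 else 0 := fun _ _ _ => rfl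
  ext a c
  rw [slice_apply]
  dsimp only [tgt]
  -- only `b₀ = (a.1, j ↦ ((a.2 j).1, (c.2 j).1))` contributes
  set b₀ : J N m := (a.1, fun j => ((a.2 j).1, (c.2 j).1)) with hb₀
  rw [Finset.sum_eq_single b₀]
  · -- the value at `b₀`
    by_cases hac : a = c
    · subst hac
      have hw : idWeight N m b₀ = 1 := by simp [idWeight, hb₀]
      rw [hw, one_mul, Matrix.one_apply_eq, kroneckerTensor_apply, kroneckerPow_apply]
      simp [hb₀, matMulTensor_apply']
    · rw [Matrix.one_apply_ne hac]
      by_cases h1 : a.1 = c.1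
      · have h2 : a.2 ≠ c.2 := fun h2 => hac (Prod.ext h1 h2)
        obtain ⟨j, hj⟩ := Function.ne_iff.mp h2
        by_cases hj1 : (a.2 j).1 = (c.2 j).1
        · have hj2 : (a.2 j).2 ≠ (c.2 j).2 := fun hj2 => hj (Prod.ext hj1 hj2)
          rw [kroneckerTensor_apply, kroneckerPow_apply,
            Finset.prod_eq_zero (Finset.mem_univ j), mul_zero, mul_zero]
          simp [hb₀, matMulTensor_apply', hj2]
        · have hw : idWeight N m b₀ = 0 := by
            simp only [idWeight, hb₀, ite_eq_right_iff, one_ne_zero, imp_false, not_forall]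
            exact ⟨j, hj1⟩
          rw [hw, zero_mul]
      · rw [kroneckerTensor_apply, unitTensor_apply, if_neg (fun h => h1 (h.1.trans h.2)),
          zero_mul, mul_zero]
  · -- other `b` vanish
    intro b _ hb
    by_cases h1 : a.1 = b.1
    · have h2 : b.2 ≠ b₀.2 := fun h2 => hb (Prod.ext h1.symm h2)
      obtain ⟨j, hj⟩ := Function.ne_iff.mp h2
      rw [kroneckerTensor_apply, kroneckerPow_apply, Finset.prod_eq_zero (Finset.mem_univ j),
        mul_zero, mul_zero]
      rw [matMulTensor_apply', if_neg]
      rintro ⟨e1, e2, -⟩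
      exact hj (Prod.ext e1.symm e2)
    · rw [kroneckerTensor_apply, unitTensor_apply, if_neg (fun h => h1 h.1), zero_mul, mul_zero]
  · exact fun h => absurd (Finset.mem_univ b₀) h

end Sides

/-! ## 3. No tight exchange -/

/-- **No tight exchange at any level or multiplicity**: for `N, m ≥ 1`,
`⟨m⟩ ⊠ C₁^{⊠N}` does not restrict to `⟨m⟩ ⊠ ⟨2,2,2⟩^{⊠N}` (`m = 1` is Kernel II, `not_helped_one`).
[cite: CoppersmithWinograd1990, §7] -/
theorem not_tight {N m : ℕ} (hN : 1 ≤ N) (hm : 1 ≤ m) :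
    ¬ TensorRestrictsTo (kroneckerTensor (unitTensor ℂ m) (kroneckerPow coupling₁ N))
        (kroneckerTensor (unitTensor ℂ m) (kroneckerPow (matMulTensor ℂ 2 2 2) N)) := by
  intro h
  obtain ⟨A, B, C, hABC⟩ := (src_restrictsTo_coupling N m).trans h
  have key := slice_restrict A B C hABC (idWeight N m)
  rw [slice_tgt_idWeight] at key
  set ω : J N m → ℂ := fun b => ∑ b', idWeight N m b' * B b' b with hω
  have hS : IsUnit (slice (src N m) ω) := isUnit_of_conj_eq_one _ _ _ key.symm
  have hρ := mulVec_eq_zero_of_isUnit hS (slice_mulVec_sgn hN ω)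
  have hω0 : ω = 0 := by
    funext z
    have hz := congrFun hρ z
    simp only [Pi.zero_apply] at hz ⊢
    have := congrArg (fun x => sgn hN z * x) hz
    simpa only [← mul_assoc, sgn_mul_self, one_mul, mul_zero] using this
  have h0 : slice (src N m) ω = 0 := by
    ext a c; simp [hω0]
  rw [h0, Matrix.mul_zero, Matrix.zero_mul] at key
  let x₀ : J N m := (⟨0, hm⟩, fun _ => ((0 : Fin 2), (0 : Fin 2)))
  have h10 := congrFun (congrFun key x₀) x₀
  rw [Matrix.one_apply_eq, Matrix.zero_apply] at h10
  exact one_ne_zero h10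

/-- The gauge-point count: an amortised certificate `⟨B⟩ ⊠ C₁^{⊠N} ⊵ ⟨m⟩ ⊠ ⟨2,2,2⟩^{⊠N}` (even as a
degeneration) has `m ≤ B`, since `ζ⁽¹⁾(C₁) = ζ⁽¹⁾⟨2,2,2⟩ = 4`. [cite: ChristandlVranaZuiddam2023, Ex. 1.4] -/
theorem le_of_amortised {N B m : ℕ}
    (h : AlgDegeneratesTo (kroneckerTensor (unitTensor ℂ B) (kroneckerPow coupling₁ N))
      (kroneckerTensor (unitTensor ℂ m) (kroneckerPow (matMulTensor ℂ 2 2 2) N))) :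
    m ≤ B := by
  have key := OutsiderSandwichAmortised.spectral_of_amortised h
    (gaugePoint₁_isUniversalSpectralPoint ℂ)
  rw [OutsiderSandwichContactFace.gaugePoint₁_matMulTensor_two,
    OutsiderSandwichExchangeSpectral.gaugePoint₁_coupling₁] at key
  have h4 : (0 : ℝ) < 4 ^ N := by positivity
  exact_mod_cast le_of_mul_le_mul_right key h4

/-- **The amortised exchange table starts at `m + 1`**: `⟨B⟩ ⊠ C₁^{⊠N} ⊵ ⟨m⟩ ⊠ ⟨2,2,2⟩^{⊠N}` with
`N, m ≥ 1` forces `m + 1 ≤ B`. [cite: CoppersmithWinograd1990, §7] -/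
theorem succ_le_of_amortised {N B m : ℕ} (hN : 1 ≤ N) (hm : 1 ≤ m)
    (h : TensorRestrictsTo (kroneckerTensor (unitTensor ℂ B) (kroneckerPow coupling₁ N))
      (kroneckerTensor (unitTensor ℂ m) (kroneckerPow (matMulTensor ℂ 2 2 2) N))) :
    m + 1 ≤ B := by
  have hle : m ≤ B := le_of_amortised h.algDegeneratesTo
  rcases hle.lt_or_eq with hlt | heq
  · exact hlt
  · subst heq
    exact absurd h (not_tight hN hm)

/-- **`r(1, 2) = 3`**: two copies of `C₁` do not give two independent `2 × 2` products, three do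
(`OutsiderSandwichYield`). [cite: CoppersmithWinograd1990, §7] -/
theorem amortised_one_two :
    ¬ TensorRestrictsTo (kroneckerTensor (unitTensor ℂ 2) (kroneckerPow coupling₁ 1))
        (kroneckerTensor (unitTensor ℂ 2) (kroneckerPow (matMulTensor ℂ 2 2 2) 1)) ∧
      TensorRestrictsTo (kroneckerTensor (unitTensor ℂ 3) (kroneckerPow coupling₁ 1))
        (kroneckerTensor (unitTensor ℂ 2) (kroneckerPow (matMulTensor ℂ 2 2 2) 1)) :=
  ⟨not_tight le_rfl (by norm_num), OutsiderSandwichYield.unitThree_coupling₁_restrictsTo_unitTwo_matMul⟩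

end Summit.MatrixMultiplication.MatrixMultiplication.Theorems.OutsiderSandwichNoTightExchange
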